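import Mathlib
import HarnessLib
import Summits.Ventures.LatticeQCDFlow.Exactness.U1WilsonFlowLOExactForceLipschitz
import Summits.Ventures.LatticeQCDFlow.Exactness.U1WilsonFlowLOMemberFTHMCN
import Summits.Ventures.LatticeQCDFlow.Exactness.U1WilsonFlowLOContinuity
import Summits.Ventures.LatticeQCDFlow.Exactness.U1LeapfrogHMCWilson

/-!
# `U(1)` rung: FT-HMC through the LO Wilson-flow member WITH THE ENGINE'S EXACT AUTODIFF FORCE converges to the Wilson measure from every start — single step unconditionally, `n` steps in an EXPLICIT short-trajectory window; nothing left abstract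

HONEST FRAMING: exact (Metropolis-corrected) sampling algorithms for lattice gauge theory;
figures of merit are autocorrelation/cost numbers at stated couplings and volumes; no
continuum-physics claim.

Venture `LatticeQCDFlow` (cell pub-lqcd), topic `Exactness`; FANOUT row 14 (`eng-flowhmc`, engine
`latflow.fthmc`, family B, `U(1)` rung; member `maps.u1_wilson_flow_lo`, any schedule of masked
sub-steps packaged VERBATIM as in `exists_layers_u1WilsonFlowLO`; the momentum increment IS the
engine's: `g(V)(e) = κ_f · fderiv (p ↦ (β S_W∘F − log J)(e^(icp)·V)) 0 (δ_e)`).  NEW WORK of the cell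
over this row's `U1WilsonFlowLOExactForceLipschitz` (the force through the member is bounded by
`b̄(N)` and `K̄(N)`-Lipschitz, explicit and volume-independent), GEN-9's `U1FTHMCErgodic`
(`u1LeapfrogFTHMC_uniformlyErgodic`), ROW 9's `U1MultiStepFTHMCErgodic`
(`u1LeapfrogFTHMCN_uniformlyErgodic`), GEN-10's `U1WilsonFlowLOContinuity` / `U1FTHMCGaugeCovariance`
(`measurable_u1ExactForce`), row 9's `U1LeapfrogHMCWilson` (`u1GibbsLaw_eq_wilsonMeasure`); nothing is
cited as a fact; no number.

With `N` = number of layers, `A = 8(d−1)|ε|`, `m = 1 − 2(d−1)|ε|`, `b₀ = 2(d−1)|βcκ_f|`, `K₀ = 8(d−1)|βcκ_f|`,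
`u = |κ_f||c||ε|·8(d−1)/m`, `w = |κ_f||c||ε|(32(d−1)/m + 64(d−1)²|ε|/m²)`,
`K̄(N) = (1+A)^(2N) (K₀ + N(4A(b₀ + Nu) + w))`:

* **`u1WilsonFlowLO_member_fthmc_exactForce_uniformlyErgodic`** — SINGLE-STEP FT-HMC through the
  member with the exact force converges to `wilsonMeasure u1Rep β` geometrically from EVERY initial
  law, for every `L ≥ 2`, proper colouring, `2(d−1)|ε| < 1`, schedule, `β, c, κ_f`, `ε', κ' > 0` —
  NO FURTHER HYPOTHESIS;
* **`u1WilsonFlowLO_member_fthmcN_exactForce_uniformlyErgodic`** — the `n`-STEP chain (row 9's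
  `u1LeapfrogHMCN`) with the exact force converges to `wilsonMeasure u1Rep β` from every start whenever
  `4 · K̄(N) · ε' · n² ≤ 3` — the short-trajectory window now EXPLICIT in `(β, c, κ_f, ε, N, d)` and
  uniform in the volume; **`wilsonMeasure_unique_invariant_u1WilsonFlowLO_member_fthmcN_exactForce`**
  — and `wilsonMeasure u1Rep β` is the UNIQUE invariant probability law of that kernel.

NOT CLAIMED: longer trajectories; sharp constants; `L = 1`; `SU(2)`; OMF words (same bounds feed
`u1Omf2FTHMC_pow_uniformlyErgodic`, not instantiated here); floating point; any number.
-/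

noncomputable section

namespace Summit.Ventures.LatticeQCDFlow.Exactness

open Set MeasureTheory
open ProbabilityTheory ProbabilityTheory.Kernel
open Literature.MathematicalPhysics.QuantumFieldTheory Literature.MathematicalPhysics.QuantumLattice
open scoped ENNReal NNReal

variable {d L : ℕ} {X : Type*} [DecidableEq X] (χ : Site d L → X) [NeZero L]

/-- **SINGLE-STEP FT-HMC THROUGH THE `U(1)` LO MEMBER WITH THE EXACT AUTODIFF FORCE CONVERGES TO THE
WILSON MEASURE FROM EVERY START — nothing left to assume.** -/
theorem u1WilsonFlowLO_member_fthmc_exactForce_uniformlyErgodic (hL : 2 ≤ L)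
    (hχ : ∀ (x : Site d L) (i : Fin d), χ (x.shift i) ≠ χ x) {ε : ℝ}
    (hε : |ε| * (2 * ((d - 1 : ℕ) : ℝ)) < 1) (sched : List (Fin d × X)) (β c κf : ℝ)
    {ε' κ' : ℝ} (hε' : 0 < ε') (hκ' : 0 < κ') :
    ∃ layers : List ((GaugeConfig d L Circle ≃ᵐ GaugeConfig d L Circle) × (GaugeConfig d L Circle → ℝ)),
      layers.map (fun Ly => ((Ly.1 : GaugeConfig d L Circle → GaugeConfig d L Circle), Ly.2)) = sched.map (fun s =>
        ((fun (V : GaugeConfig d L Circle) (e : Edge d L) => if e.2 = s.1 ∧ χ e.1 = s.2 then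
          V e * Circle.exp (ε * ∑ ν ∈ Finset.univ.erase e.2,
            (((plaquetteHolonomy V (e.1 - Pi.single ν 1) e.2 ν : Circle) : ℂ).im -
              ((plaquetteHolonomy V e.1 e.2 ν : Circle) : ℂ).im)) else V e),
         fun V : GaugeConfig d L Circle => ∏ a : {e : Edge d L // e.2 = s.1 ∧ χ e.1 = s.2},
          (1 - ε * ∑ ν ∈ Finset.univ.erase a.1.2,
            (((plaquetteHolonomy V a.1.1 a.1.2 ν : Circle) : ℂ).re +
              ((plaquetteHolonomy V (a.1.1 - Pi.single ν 1) a.1.2 ν : Circle) : ℂ).re)))) ∧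
      ∃ hg : Measurable (fun V : GaugeConfig d L Circle => (fun i : Edge d L => κf * fderiv ℝ (fun p : (Edge d L → ℝ) =>
        (fun W : GaugeConfig d L Circle => β * wilsonAction u1Rep ((layers.foldr (fun Ly (F : GaugeConfig d L Circle ≃ᵐ GaugeConfig d L Circle) => Ly.1.trans F) (MeasurableEquiv.refl (GaugeConfig d L Circle))) W) - Real.log ((layers.foldr (fun Ly K => fun v => Ly.2 v * K (Ly.1 v)) (fun _ => (1 : ℝ))) W)) ((fun i : Edge d L => Circle.exp (c * p i)) * V)) 0 (Pi.single i 1))),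
      ∃ δ : ℝ, 0 < δ ∧ δ ≤ 1 ∧ ∀ (μ₀ : Measure (GaugeConfig d L Circle)) [IsProbabilityMeasure μ₀]
        (t : ℕ) (A : Set (GaugeConfig d L Circle)),
        |((fun m : Measure (GaugeConfig d L Circle) =>
              m.bind (conjKernel (u1LeapfrogHMC ε' κ' hg (fun V =>
                  β * wilsonAction u1Rep ((layers.foldr
                    (fun Ly (F : GaugeConfig d L Circle ≃ᵐ GaugeConfig d L Circle) => Ly.1.trans F)
                    (MeasurableEquiv.refl (GaugeConfig d L Circle))) V) -
                    Real.log ((layers.foldr (fun Ly K => fun v => Ly.2 v * K (Ly.1 v))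
                      (fun _ => (1 : ℝ))) V)))
                (layers.foldr (fun Ly (F : GaugeConfig d L Circle ≃ᵐ GaugeConfig d L Circle) =>
                  Ly.1.trans F) (MeasurableEquiv.refl (GaugeConfig d L Circle)))))^[t] μ₀).real A
            - (wilsonMeasure (d := d) (L := L) u1Rep β).real A| ≤ (1 - δ) ^ t := by
  obtain ⟨layers, hmap, hpos, hmeas, hjac⟩ := exists_layers_u1WilsonFlowLO χ hχ hε sched
  refine ⟨layers, hmap, ?_⟩
  have hS0c : Continuous fun U : GaugeConfig d L Circle => β * wilsonAction u1Rep U :=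
    continuous_smul_wilsonAction u1Rep continuous_u1Rep β
  have hSc := u1WilsonFlowLO_member_ftAction_continuous χ ε sched layers hmap hpos hS0c
  refine ⟨measurable_u1ExactForce hSc c κf, ?_⟩
  obtain ⟨-, hB, -⟩ := u1WilsonFlowLO_member_exactForce_bounds χ hL hε sched layers hmap hpos β c κf
  have hm : 0 < 1 - |ε| * (2 * ((d - 1 : ℕ) : ℝ)) := by linarith
  have hb0 : 0 ≤ (1 + 8 * ((d - 1 : ℕ) : ℝ) * |ε|) ^ sched.length *
        (2 * ((d - 1 : ℕ) : ℝ) * |β * c * κf| + (sched.length : ℝ) *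
          (|κf| * |c| * |ε| * (8 * ((d - 1 : ℕ) : ℝ)) / (1 - |ε| * (2 * ((d - 1 : ℕ) : ℝ))))) := by
    positivity
  have hb : ∀ (u : GaugeConfig d L Circle) (l : Edge d L),
      ‖(fun V : GaugeConfig d L Circle => (fun i : Edge d L => κf * fderiv ℝ (fun p : (Edge d L → ℝ) =>
        (fun W : GaugeConfig d L Circle => β * wilsonAction u1Rep ((layers.foldr (fun Ly (F : GaugeConfig d L Circle ≃ᵐ GaugeConfig d L Circle) => Ly.1.trans F) (MeasurableEquiv.refl (GaugeConfig d L Circle))) W) - Real.log ((layers.foldr (fun Ly K => fun v => Ly.2 v * K (Ly.1 v)) (fun _ => (1 : ℝ))) W)) ((fun i : Edge d L => Circle.exp (c * p i)) * V)) 0 (Pi.single i 1))) u l‖ ≤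
      (1 + 8 * ((d - 1 : ℕ) : ℝ) * |ε|) ^ sched.length *
        (2 * ((d - 1 : ℕ) : ℝ) * |β * c * κf| + (sched.length : ℝ) *
          (|κf| * |c| * |ε| * (8 * ((d - 1 : ℕ) : ℝ)) / (1 - |ε| * (2 * ((d - 1 : ℕ) : ℝ))))) := by
    intro u l
    rw [Real.norm_eq_abs]
    exact hB u l
  -- pinched Jacobian of the member
  obtain ⟨-, hfmeas, hfjac⟩ := hasJacobian_foldr_trans layers hpos hmeas hjac
  have hpinch := u1WilsonFlowLO_layers_pinched χ hε.le sched layers hmap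
  have hfold := fun v => foldr_logDet_mem_Icc layers (pow_nonneg hm.le _) hpinch v
  obtain ⟨s, hs⟩ := exists_bound_smul_wilsonAction_circle (d := d) (L := L) u1Rep continuous_u1Rep β
  obtain ⟨δ, hδ0, hδ1, hbound⟩ := u1LeapfrogFTHMC_uniformlyErgodic
    (S := fun U : GaugeConfig d L Circle => β * wilsonAction u1Rep U) hε' hκ'
    (measurable_u1ExactForce hSc c κf) hb0 hb hS0c.measurable hs (pow_pos (pow_pos hm _) _)
    (fun v => (hfold v).1) (fun v => (hfold v).2) hfmeas hfjac
  refine ⟨δ, hδ0, hδ1, fun μ₀ _ t A => ?_⟩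
  rw [← u1GibbsLaw_eq_wilsonMeasure (d := d) (L := L) u1Rep β]
  exact hbound μ₀ t A

/-- **MULTI-STEP FT-HMC THROUGH THE `U(1)` LO MEMBER WITH THE EXACT AUTODIFF FORCE CONVERGES TO THE
WILSON MEASURE FROM EVERY START IN AN EXPLICIT SHORT-TRAJECTORY WINDOW** `4·K̄(N)·ε'·n² ≤ 3` (see the
module docstring for `K̄`). -/
theorem u1WilsonFlowLO_member_fthmcN_exactForce_uniformlyErgodic (hL : 2 ≤ L)
    (hχ : ∀ (x : Site d L) (i : Fin d), χ (x.shift i) ≠ χ x) {ε : ℝ}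
    (hε : |ε| * (2 * ((d - 1 : ℕ) : ℝ)) < 1) (sched : List (Fin d × X)) (β c κf : ℝ)
    {ε' κ' : ℝ} (hε' : 0 < ε') (hκ' : 0 < κ') {n : ℕ} (hn : 1 ≤ n)
    (hshort : 4 * ((1 + 8 * ((d - 1 : ℕ) : ℝ) * |ε|) ^ (2 * sched.length) *
        (8 * ((d - 1 : ℕ) : ℝ) * |β * c * κf| + (sched.length : ℝ) *
          (4 * (8 * ((d - 1 : ℕ) : ℝ) * |ε|) *
            (2 * ((d - 1 : ℕ) : ℝ) * |β * c * κf| + (sched.length : ℝ) *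
              (|κf| * |c| * |ε| * (8 * ((d - 1 : ℕ) : ℝ)) / (1 - |ε| * (2 * ((d - 1 : ℕ) : ℝ))))) +
           |κf| * |c| * |ε| * (32 * ((d - 1 : ℕ) : ℝ) / (1 - |ε| * (2 * ((d - 1 : ℕ) : ℝ))) +
             64 * ((d - 1 : ℕ) : ℝ) ^ 2 * |ε| / (1 - |ε| * (2 * ((d - 1 : ℕ) : ℝ))) ^ 2)))) *
        ε' * (n : ℝ) ^ 2 ≤ 3) :
    ∃ layers : List ((GaugeConfig d L Circle ≃ᵐ GaugeConfig d L Circle) × (GaugeConfig d L Circle → ℝ)),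
      layers.map (fun Ly => ((Ly.1 : GaugeConfig d L Circle → GaugeConfig d L Circle), Ly.2)) = sched.map (fun s =>
        ((fun (V : GaugeConfig d L Circle) (e : Edge d L) => if e.2 = s.1 ∧ χ e.1 = s.2 then
          V e * Circle.exp (ε * ∑ ν ∈ Finset.univ.erase e.2,
            (((plaquetteHolonomy V (e.1 - Pi.single ν 1) e.2 ν : Circle) : ℂ).im -
              ((plaquetteHolonomy V e.1 e.2 ν : Circle) : ℂ).im)) else V e),
         fun V : GaugeConfig d L Circle => ∏ a : {e : Edge d L // e.2 = s.1 ∧ χ e.1 = s.2},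
          (1 - ε * ∑ ν ∈ Finset.univ.erase a.1.2,
            (((plaquetteHolonomy V a.1.1 a.1.2 ν : Circle) : ℂ).re +
              ((plaquetteHolonomy V (a.1.1 - Pi.single ν 1) a.1.2 ν : Circle) : ℂ).re)))) ∧
      ∃ hg : Measurable (fun V : GaugeConfig d L Circle => (fun i : Edge d L => κf * fderiv ℝ (fun p : (Edge d L → ℝ) =>
        (fun W : GaugeConfig d L Circle => β * wilsonAction u1Rep ((layers.foldr (fun Ly (F : GaugeConfig d L Circle ≃ᵐ GaugeConfig d L Circle) => Ly.1.trans F) (MeasurableEquiv.refl (GaugeConfig d L Circle))) W) - Real.log ((layers.foldr (fun Ly K => fun v => Ly.2 v * K (Ly.1 v)) (fun _ => (1 : ℝ))) W)) ((fun i : Edge d L => Circle.exp (c * p i)) * V)) 0 (Pi.single i 1))),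
      ∃ δ : ℝ, 0 < δ ∧ δ ≤ 1 ∧ ∀ (μ₀ : Measure (GaugeConfig d L Circle)) [IsProbabilityMeasure μ₀]
        (t : ℕ) (A : Set (GaugeConfig d L Circle)),
        |((fun m : Measure (GaugeConfig d L Circle) =>
              m.bind (conjKernel (u1LeapfrogHMCN ε' κ' hg (fun V =>
                  β * wilsonAction u1Rep ((layers.foldr
                    (fun Ly (F : GaugeConfig d L Circle ≃ᵐ GaugeConfig d L Circle) => Ly.1.trans F)
                    (MeasurableEquiv.refl (GaugeConfig d L Circle))) V) -
                    Real.log ((layers.foldr (fun Ly K => fun v => Ly.2 v * K (Ly.1 v))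
                      (fun _ => (1 : ℝ))) V)) n)
                (layers.foldr (fun Ly (F : GaugeConfig d L Circle ≃ᵐ GaugeConfig d L Circle) =>
                  Ly.1.trans F) (MeasurableEquiv.refl (GaugeConfig d L Circle)))))^[t] μ₀).real A
            - (wilsonMeasure (d := d) (L := L) u1Rep β).real A| ≤ (1 - δ) ^ t := by
  obtain ⟨layers, hmap, hpos, hmeas, hjac⟩ := exists_layers_u1WilsonFlowLO χ hχ hε sched
  refine ⟨layers, hmap, ?_⟩
  have hS0c : Continuous fun U : GaugeConfig d L Circle => β * wilsonAction u1Rep U :=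
    continuous_smul_wilsonAction u1Rep continuous_u1Rep β
  have hSc := u1WilsonFlowLO_member_ftAction_continuous χ ε sched layers hmap hpos hS0c
  refine ⟨measurable_u1ExactForce hSc c κf, ?_⟩
  obtain ⟨-, hB, hK⟩ := u1WilsonFlowLO_member_exactForce_bounds χ hL hε sched layers hmap hpos β c κf
  have hm : 0 < 1 - |ε| * (2 * ((d - 1 : ℕ) : ℝ)) := by linarith
  have hb0 : 0 ≤ (1 + 8 * ((d - 1 : ℕ) : ℝ) * |ε|) ^ sched.length *
        (2 * ((d - 1 : ℕ) : ℝ) * |β * c * κf| + (sched.length : ℝ) *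
          (|κf| * |c| * |ε| * (8 * ((d - 1 : ℕ) : ℝ)) / (1 - |ε| * (2 * ((d - 1 : ℕ) : ℝ))))) := by
    positivity
  have hK0 : 0 ≤ (1 + 8 * ((d - 1 : ℕ) : ℝ) * |ε|) ^ (2 * sched.length) *
        (8 * ((d - 1 : ℕ) : ℝ) * |β * c * κf| + (sched.length : ℝ) *
          (4 * (8 * ((d - 1 : ℕ) : ℝ) * |ε|) *
            (2 * ((d - 1 : ℕ) : ℝ) * |β * c * κf| + (sched.length : ℝ) *
              (|κf| * |c| * |ε| * (8 * ((d - 1 : ℕ) : ℝ)) / (1 - |ε| * (2 * ((d - 1 : ℕ) : ℝ))))) +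
           |κf| * |c| * |ε| * (32 * ((d - 1 : ℕ) : ℝ) / (1 - |ε| * (2 * ((d - 1 : ℕ) : ℝ))) +
             64 * ((d - 1 : ℕ) : ℝ) ^ 2 * |ε| / (1 - |ε| * (2 * ((d - 1 : ℕ) : ℝ))) ^ 2))) := by
    positivity
  have hb : ∀ (u : GaugeConfig d L Circle) (l : Edge d L),
      ‖(fun V : GaugeConfig d L Circle => (fun i : Edge d L => κf * fderiv ℝ (fun p : (Edge d L → ℝ) =>
        (fun W : GaugeConfig d L Circle => β * wilsonAction u1Rep ((layers.foldr (fun Ly (F : GaugeConfig d L Circle ≃ᵐ GaugeConfig d L Circle) => Ly.1.trans F) (MeasurableEquiv.refl (GaugeConfig d L Circle))) W) - Real.log ((layers.foldr (fun Ly K => fun v => Ly.2 v * K (Ly.1 v)) (fun _ => (1 : ℝ))) W)) ((fun i : Edge d L => Circle.exp (c * p i)) * V)) 0 (Pi.single i 1))) u l‖ ≤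
      (1 + 8 * ((d - 1 : ℕ) : ℝ) * |ε|) ^ sched.length *
        (2 * ((d - 1 : ℕ) : ℝ) * |β * c * κf| + (sched.length : ℝ) *
          (|κf| * |c| * |ε| * (8 * ((d - 1 : ℕ) : ℝ)) / (1 - |ε| * (2 * ((d - 1 : ℕ) : ℝ))))) := by
    intro u l
    rw [Real.norm_eq_abs]
    exact hB u l
  have hgK : LipschitzWith (Real.toNNReal ((1 + 8 * ((d - 1 : ℕ) : ℝ) * |ε|) ^ (2 * sched.length) *
        (8 * ((d - 1 : ℕ) : ℝ) * |β * c * κf| + (sched.length : ℝ) *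
          (4 * (8 * ((d - 1 : ℕ) : ℝ) * |ε|) *
            (2 * ((d - 1 : ℕ) : ℝ) * |β * c * κf| + (sched.length : ℝ) *
              (|κf| * |c| * |ε| * (8 * ((d - 1 : ℕ) : ℝ)) / (1 - |ε| * (2 * ((d - 1 : ℕ) : ℝ))))) +
           |κf| * |c| * |ε| * (32 * ((d - 1 : ℕ) : ℝ) / (1 - |ε| * (2 * ((d - 1 : ℕ) : ℝ))) +
             64 * ((d - 1 : ℕ) : ℝ) ^ 2 * |ε| / (1 - |ε| * (2 * ((d - 1 : ℕ) : ℝ))) ^ 2)))))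
      (fun V : GaugeConfig d L Circle => (fun i : Edge d L => κf * fderiv ℝ (fun p : (Edge d L → ℝ) =>
        (fun W : GaugeConfig d L Circle => β * wilsonAction u1Rep ((layers.foldr (fun Ly (F : GaugeConfig d L Circle ≃ᵐ GaugeConfig d L Circle) => Ly.1.trans F) (MeasurableEquiv.refl (GaugeConfig d L Circle))) W) - Real.log ((layers.foldr (fun Ly K => fun v => Ly.2 v * K (Ly.1 v)) (fun _ => (1 : ℝ))) W)) ((fun i : Edge d L => Circle.exp (c * p i)) * V)) 0 (Pi.single i 1))) := by
    refine LipschitzWith.of_dist_le_mul fun V V' => ?_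
    rw [Real.coe_toNNReal _ hK0]
    refine (dist_pi_le_iff (by positivity)).2 fun e => ?_
    rw [Real.dist_eq]
    exact hK V V' e
  -- pinched Jacobian of the member
  obtain ⟨-, hfmeas, hfjac⟩ := hasJacobian_foldr_trans layers hpos hmeas hjac
  have hpinch := u1WilsonFlowLO_layers_pinched χ hε.le sched layers hmap
  have hfold := fun v => foldr_logDet_mem_Icc layers (pow_nonneg hm.le _) hpinch v
  obtain ⟨s, hs⟩ := exists_bound_smul_wilsonAction_circle (d := d) (L := L) u1Rep continuous_u1Rep β
  have hshort' : 4 * ((Real.toNNReal ((1 + 8 * ((d - 1 : ℕ) : ℝ) * |ε|) ^ (2 * sched.length) *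
        (8 * ((d - 1 : ℕ) : ℝ) * |β * c * κf| + (sched.length : ℝ) *
          (4 * (8 * ((d - 1 : ℕ) : ℝ) * |ε|) *
            (2 * ((d - 1 : ℕ) : ℝ) * |β * c * κf| + (sched.length : ℝ) *
              (|κf| * |c| * |ε| * (8 * ((d - 1 : ℕ) : ℝ)) / (1 - |ε| * (2 * ((d - 1 : ℕ) : ℝ))))) +
           |κf| * |c| * |ε| * (32 * ((d - 1 : ℕ) : ℝ) / (1 - |ε| * (2 * ((d - 1 : ℕ) : ℝ))) +
             64 * ((d - 1 : ℕ) : ℝ) ^ 2 * |ε| / (1 - |ε| * (2 * ((d - 1 : ℕ) : ℝ))) ^ 2)))) : ℝ≥0) : ℝ) *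
      ε' * (n : ℝ) ^ 2 ≤ 3 := by
    rw [Real.coe_toNNReal _ hK0]
    exact hshort
  obtain ⟨δ, hδ0, hδ1, hbound⟩ := u1LeapfrogFTHMCN_uniformlyErgodic
    (S := fun U : GaugeConfig d L Circle => β * wilsonAction u1Rep U) hε' hκ' hn
    (measurable_u1ExactForce hSc c κf) hgK hshort' hb0 hb hS0c.measurable hs
    (pow_pos (pow_pos hm _) _) (fun v => (hfold v).1) (fun v => (hfold v).2) hfmeas hfjac
  refine ⟨δ, hδ0, hδ1, fun μ₀ _ t A => ?_⟩
  rw [← u1GibbsLaw_eq_wilsonMeasure (d := d) (L := L) u1Rep β]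
  exact hbound μ₀ t A

/-- **… and the Wilson measure is the UNIQUE invariant probability law of that reported `n`-step
kernel** (same explicit window). -/
theorem wilsonMeasure_unique_invariant_u1WilsonFlowLO_member_fthmcN_exactForce (hL : 2 ≤ L)
    (hχ : ∀ (x : Site d L) (i : Fin d), χ (x.shift i) ≠ χ x) {ε : ℝ}
    (hε : |ε| * (2 * ((d - 1 : ℕ) : ℝ)) < 1) (sched : List (Fin d × X)) (β c κf : ℝ)
    {ε' κ' : ℝ} (hε' : 0 < ε') (hκ' : 0 < κ') {n : ℕ} (hn : 1 ≤ n)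
    (hshort : 4 * ((1 + 8 * ((d - 1 : ℕ) : ℝ) * |ε|) ^ (2 * sched.length) *
        (8 * ((d - 1 : ℕ) : ℝ) * |β * c * κf| + (sched.length : ℝ) *
          (4 * (8 * ((d - 1 : ℕ) : ℝ) * |ε|) *
            (2 * ((d - 1 : ℕ) : ℝ) * |β * c * κf| + (sched.length : ℝ) *
              (|κf| * |c| * |ε| * (8 * ((d - 1 : ℕ) : ℝ)) / (1 - |ε| * (2 * ((d - 1 : ℕ) : ℝ))))) +
           |κf| * |c| * |ε| * (32 * ((d - 1 : ℕ) : ℝ) / (1 - |ε| * (2 * ((d - 1 : ℕ) : ℝ))) +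
             64 * ((d - 1 : ℕ) : ℝ) ^ 2 * |ε| / (1 - |ε| * (2 * ((d - 1 : ℕ) : ℝ))) ^ 2)))) *
        ε' * (n : ℝ) ^ 2 ≤ 3) :
    ∃ layers : List ((GaugeConfig d L Circle ≃ᵐ GaugeConfig d L Circle) × (GaugeConfig d L Circle → ℝ)),
      layers.map (fun Ly => ((Ly.1 : GaugeConfig d L Circle → GaugeConfig d L Circle), Ly.2)) = sched.map (fun s =>
        ((fun (V : GaugeConfig d L Circle) (e : Edge d L) => if e.2 = s.1 ∧ χ e.1 = s.2 then
          V e * Circle.exp (ε * ∑ ν ∈ Finset.univ.erase e.2,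
            (((plaquetteHolonomy V (e.1 - Pi.single ν 1) e.2 ν : Circle) : ℂ).im -
              ((plaquetteHolonomy V e.1 e.2 ν : Circle) : ℂ).im)) else V e),
         fun V : GaugeConfig d L Circle => ∏ a : {e : Edge d L // e.2 = s.1 ∧ χ e.1 = s.2},
          (1 - ε * ∑ ν ∈ Finset.univ.erase a.1.2,
            (((plaquetteHolonomy V a.1.1 a.1.2 ν : Circle) : ℂ).re +
              ((plaquetteHolonomy V (a.1.1 - Pi.single ν 1) a.1.2 ν : Circle) : ℂ).re)))) ∧
      ∃ hg : Measurable (fun V : GaugeConfig d L Circle => (fun i : Edge d L => κf * fderiv ℝ (fun p : (Edge d L → ℝ) =>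
        (fun W : GaugeConfig d L Circle => β * wilsonAction u1Rep ((layers.foldr (fun Ly (F : GaugeConfig d L Circle ≃ᵐ GaugeConfig d L Circle) => Ly.1.trans F) (MeasurableEquiv.refl (GaugeConfig d L Circle))) W) - Real.log ((layers.foldr (fun Ly K => fun v => Ly.2 v * K (Ly.1 v)) (fun _ => (1 : ℝ))) W)) ((fun i : Edge d L => Circle.exp (c * p i)) * V)) 0 (Pi.single i 1))),
      ∀ (π' : Measure (GaugeConfig d L Circle)) [IsProbabilityMeasure π'],
        Invariant (conjKernel (u1LeapfrogHMCN ε' κ' hg (fun V =>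
                  β * wilsonAction u1Rep ((layers.foldr
                    (fun Ly (F : GaugeConfig d L Circle ≃ᵐ GaugeConfig d L Circle) => Ly.1.trans F)
                    (MeasurableEquiv.refl (GaugeConfig d L Circle))) V) -
                    Real.log ((layers.foldr (fun Ly K => fun v => Ly.2 v * K (Ly.1 v))
                      (fun _ => (1 : ℝ))) V)) n)
                (layers.foldr (fun Ly (F : GaugeConfig d L Circle ≃ᵐ GaugeConfig d L Circle) =>
                  Ly.1.trans F) (MeasurableEquiv.refl (GaugeConfig d L Circle)))) π' →
        π' = wilsonMeasure (d := d) (L := L) u1Rep β := by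
  obtain ⟨layers, hmap, hpos, hmeas, hjac⟩ := exists_layers_u1WilsonFlowLO χ hχ hε sched
  refine ⟨layers, hmap, ?_⟩
  have hS0c : Continuous fun U : GaugeConfig d L Circle => β * wilsonAction u1Rep U :=
    continuous_smul_wilsonAction u1Rep continuous_u1Rep β
  have hSc := u1WilsonFlowLO_member_ftAction_continuous χ ε sched layers hmap hpos hS0c
  refine ⟨measurable_u1ExactForce hSc c κf, ?_⟩
  obtain ⟨-, hB, hK⟩ := u1WilsonFlowLO_member_exactForce_bounds χ hL hε sched layers hmap hpos β c κf
  have hm : 0 < 1 - |ε| * (2 * ((d - 1 : ℕ) : ℝ)) := by linarith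
  have hb0 : 0 ≤ (1 + 8 * ((d - 1 : ℕ) : ℝ) * |ε|) ^ sched.length *
        (2 * ((d - 1 : ℕ) : ℝ) * |β * c * κf| + (sched.length : ℝ) *
          (|κf| * |c| * |ε| * (8 * ((d - 1 : ℕ) : ℝ)) / (1 - |ε| * (2 * ((d - 1 : ℕ) : ℝ))))) := by
    positivity
  have hK0 : 0 ≤ (1 + 8 * ((d - 1 : ℕ) : ℝ) * |ε|) ^ (2 * sched.length) *
        (8 * ((d - 1 : ℕ) : ℝ) * |β * c * κf| + (sched.length : ℝ) *
          (4 * (8 * ((d - 1 : ℕ) : ℝ) * |ε|) *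
            (2 * ((d - 1 : ℕ) : ℝ) * |β * c * κf| + (sched.length : ℝ) *
              (|κf| * |c| * |ε| * (8 * ((d - 1 : ℕ) : ℝ)) / (1 - |ε| * (2 * ((d - 1 : ℕ) : ℝ))))) +
           |κf| * |c| * |ε| * (32 * ((d - 1 : ℕ) : ℝ) / (1 - |ε| * (2 * ((d - 1 : ℕ) : ℝ))) +
             64 * ((d - 1 : ℕ) : ℝ) ^ 2 * |ε| / (1 - |ε| * (2 * ((d - 1 : ℕ) : ℝ))) ^ 2))) := by
    positivity
  have hb : ∀ (u : GaugeConfig d L Circle) (l : Edge d L),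
      ‖(fun V : GaugeConfig d L Circle => (fun i : Edge d L => κf * fderiv ℝ (fun p : (Edge d L → ℝ) =>
        (fun W : GaugeConfig d L Circle => β * wilsonAction u1Rep ((layers.foldr (fun Ly (F : GaugeConfig d L Circle ≃ᵐ GaugeConfig d L Circle) => Ly.1.trans F) (MeasurableEquiv.refl (GaugeConfig d L Circle))) W) - Real.log ((layers.foldr (fun Ly K => fun v => Ly.2 v * K (Ly.1 v)) (fun _ => (1 : ℝ))) W)) ((fun i : Edge d L => Circle.exp (c * p i)) * V)) 0 (Pi.single i 1))) u l‖ ≤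
      (1 + 8 * ((d - 1 : ℕ) : ℝ) * |ε|) ^ sched.length *
        (2 * ((d - 1 : ℕ) : ℝ) * |β * c * κf| + (sched.length : ℝ) *
          (|κf| * |c| * |ε| * (8 * ((d - 1 : ℕ) : ℝ)) / (1 - |ε| * (2 * ((d - 1 : ℕ) : ℝ))))) := by
    intro u l
    rw [Real.norm_eq_abs]
    exact hB u l
  have hgK : LipschitzWith (Real.toNNReal ((1 + 8 * ((d - 1 : ℕ) : ℝ) * |ε|) ^ (2 * sched.length) *
        (8 * ((d - 1 : ℕ) : ℝ) * |β * c * κf| + (sched.length : ℝ) *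
          (4 * (8 * ((d - 1 : ℕ) : ℝ) * |ε|) *
            (2 * ((d - 1 : ℕ) : ℝ) * |β * c * κf| + (sched.length : ℝ) *
              (|κf| * |c| * |ε| * (8 * ((d - 1 : ℕ) : ℝ)) / (1 - |ε| * (2 * ((d - 1 : ℕ) : ℝ))))) +
           |κf| * |c| * |ε| * (32 * ((d - 1 : ℕ) : ℝ) / (1 - |ε| * (2 * ((d - 1 : ℕ) : ℝ))) +
             64 * ((d - 1 : ℕ) : ℝ) ^ 2 * |ε| / (1 - |ε| * (2 * ((d - 1 : ℕ) : ℝ))) ^ 2)))))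
      (fun V : GaugeConfig d L Circle => (fun i : Edge d L => κf * fderiv ℝ (fun p : (Edge d L → ℝ) =>
        (fun W : GaugeConfig d L Circle => β * wilsonAction u1Rep ((layers.foldr (fun Ly (F : GaugeConfig d L Circle ≃ᵐ GaugeConfig d L Circle) => Ly.1.trans F) (MeasurableEquiv.refl (GaugeConfig d L Circle))) W) - Real.log ((layers.foldr (fun Ly K => fun v => Ly.2 v * K (Ly.1 v)) (fun _ => (1 : ℝ))) W)) ((fun i : Edge d L => Circle.exp (c * p i)) * V)) 0 (Pi.single i 1))) := by
    refine LipschitzWith.of_dist_le_mul fun V V' => ?_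
    rw [Real.coe_toNNReal _ hK0]
    refine (dist_pi_le_iff (by positivity)).2 fun e => ?_
    rw [Real.dist_eq]
    exact hK V V' e
  -- pinched Jacobian of the member
  obtain ⟨-, hfmeas, hfjac⟩ := hasJacobian_foldr_trans layers hpos hmeas hjac
  have hpinch := u1WilsonFlowLO_layers_pinched χ hε.le sched layers hmap
  have hfold := fun v => foldr_logDet_mem_Icc layers (pow_nonneg hm.le _) hpinch v
  obtain ⟨s, hs⟩ := exists_bound_smul_wilsonAction_circle (d := d) (L := L) u1Rep continuous_u1Rep β
  have hshort' : 4 * ((Real.toNNReal ((1 + 8 * ((d - 1 : ℕ) : ℝ) * |ε|) ^ (2 * sched.length) *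
        (8 * ((d - 1 : ℕ) : ℝ) * |β * c * κf| + (sched.length : ℝ) *
          (4 * (8 * ((d - 1 : ℕ) : ℝ) * |ε|) *
            (2 * ((d - 1 : ℕ) : ℝ) * |β * c * κf| + (sched.length : ℝ) *
              (|κf| * |c| * |ε| * (8 * ((d - 1 : ℕ) : ℝ)) / (1 - |ε| * (2 * ((d - 1 : ℕ) : ℝ))))) +
           |κf| * |c| * |ε| * (32 * ((d - 1 : ℕ) : ℝ) / (1 - |ε| * (2 * ((d - 1 : ℕ) : ℝ))) +
             64 * ((d - 1 : ℕ) : ℝ) ^ 2 * |ε| / (1 - |ε| * (2 * ((d - 1 : ℕ) : ℝ))) ^ 2)))) : ℝ≥0) : ℝ) *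
      ε' * (n : ℝ) ^ 2 ≤ 3 := by
    rw [Real.coe_toNNReal _ hK0]
    exact hshort
  intro π' _ hπ'
  rw [← u1GibbsLaw_eq_wilsonMeasure (d := d) (L := L) u1Rep β]
  exact u1LeapfrogFTHMCN_invariant_unique
    (S := fun U : GaugeConfig d L Circle => β * wilsonAction u1Rep U) hε' hκ' hn
    (measurable_u1ExactForce hSc c κf) hgK hshort' hb0 hb hS0c.measurable hs
    (pow_pos (pow_pos hm _) _) (fun v => (hfold v).1) (fun v => (hfold v).2) hfmeas hfjac hπ'

end Summit.Ventures.LatticeQCDFlow.Exactness
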